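import Summits.Ventures.CertifiedManyBodySolver.Theorems.M3x2EdgeSplitUpperEdgeCellSweepEnum
import HarnessLib

/-!
# Strip-cell certificates, bridge layer L4 at `t' = 0`: the cell Hamiltonian as product words, and the
# tree's bond image of `stripCellBondMatrix κ₀` as the verifier's sweeps

HONEST FRAMING: first certified bounds; not a superconductivity verdict; every number certified or
labelled float. Pure algebra, zero row value; `--supports` infrastructure for the FORMAT-soundness
bridge of kernel-replayed strip-cell certificates (HOME `hubbard-upper-eng-1/eng-g26/BRIDGE-SPEC.md`,
lemma group L4) toward crux `UpperEdge_le_m73o100` (route `M3x2EdgeSplit`); it closes nothing.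

The strip-cell consumers bound the energy through the dual matrix
`W = bondImage A (stripCellBondMatrix κ hc t U) + heisenberg A Z − Z` (`Upper/UMPSDualBound.lean`,
`Upper/StripCellHamiltonian.lean`: `stripCellBondMatrix κ hc t U = superSite κ (toSpin H_cell) ⊗ₖ 1 +
interCellMatrix κ hc t`, the latter an explicit sum of Kronecker products of cell product words). A
certificate verifier never forms these `4^{cW} × 4^{cW}` objects: it sweeps site by site. With the cell
tensor given site by site in the canonical enumeration, `A = cellTensor k := S ↦ wordTensor k (digits S)`
(`Theorems/M3x2EdgeSplitUpperEdgeCellSweepEnum.lean`), this file proves: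

* `toSpin_hubbardOpenBoxTT'_zero_eq_sum_productOp` — the `c × W` open Hubbard cell at `t' = 0` in
  spin language is `−t Σ_{f f' σ} [f ∼ f'] ⨂ jwWordFamily f f' c†_σ c_σ + U Σ_f ⨂ (n↑n↓ at f)`:
  a guarded sum of PRODUCT WORDS (hopping words with their Jordan–Wigner strings, on-site doublons);
* `bondImage_add/_smul/_sum` — bilinearity of the tree's bond image (via `opSandwich`);
* `opSandwich_cellTensor_toSpin_cell` — the `superSite κ₀ (toSpin H_cell)`-weighted sweep of any `M`
  is `−t Σ [f ∼ f'] (c·W sweeps of the hopping word) + U Σ_f (c·W sweeps of the doublon word)`;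
* **`bondImage_cellTensor_stripCellBondMatrix`** — the tree's `bondImage (cellTensor k)
  (stripCellBondMatrix κ₀ hc t U)` equals: `c·W` plain sweeps applied to the intra-cell sweep sum at
  `M = 1` (the «two sweeps for an intra word» rule), plus `−t Σ_{y₀ σ}` (right half-word sweeps of the
  left half-word sweeps of `1`) for the two inter-cell hopping orientations — i.e. literally the loop
  structure of a sweep-organised verifier, with every word, coefficient and nesting order fixed by the
  tree's own definitions.

Remaining for the bridge (not here): (L1/L2) decoding the emitted integer block data into `cellTensor k`
and the sweeps into kernel-checked list arithmetic; (L5–L7) the PSD/labels/assembly steps (exist in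
essence). 0 `sorry`, 0 `def` (`cellTensor` is a local notation-free abbreviation spelled out in each
statement).
-/

namespace Summit.Ventures.CertifiedManyBodySolver.Theorems

open Matrix Literature.MathematicalPhysics.QuantumLattice Literature.MathematicalPhysics.QuantumLattice.JordanWigner
  Summit.Ventures.CertifiedManyBodySolver.Upper
open scoped Kronecker

/-! ### The cell Hamiltonian as product words -/

section Words

variable {c W : ℕ}

/-- **The `c × W` open Hubbard cell (`t' = 0`) in spin language is a guarded sum of product words**:
`toSpin H_cell = −t Σ_{f f' σ} [f ∼ f'] ⨂ jwWordFamily f f' c†_σ c_σ + U Σ_f ⨂ (update 1 f (n↑n↓))`. -/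
theorem toSpin_hubbardOpenBoxTT'_zero_eq_sum_productOp (t U : ℝ) :
    toSpin (hubbardOpenBoxTT' c W t 0 U) =
      -(t : ℂ) • (∑ f : Fin c ×ₗ Fin W, ∑ f' : Fin c ×ₗ Fin W, ∑ σ : Fin 2,
          if (rectBoxGraph c W).Adj f f' then
            productOp (jwWordFamily f f' (siteCreation σ) (siteAnnihilation σ)) else 0) +
      (U : ℂ) • ∑ f : Fin c ×ₗ Fin W,
          productOp (Function.update (fun _ => (1 : Matrix (Fin 4) (Fin 4) ℂ)) f siteDouble) := by
  rw [hubbardOpenBoxTT'_tPrime_zero, toSpin_hamiltonian]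
  refine congrArg₂ (fun X Y : Op (Fin c ×ₗ Fin W) 4 => -(t : ℂ) • X + (U : ℂ) • Y) ?_ ?_
  · refine Finset.sum_congr rfl fun f _ => Finset.sum_congr rfl fun f' _ =>
      Finset.sum_congr rfl fun σ _ => ?_
    by_cases h : (rectBoxGraph c W).Adj f f'
    · rw [if_pos h, if_pos h]
      exact onSite_mul_jwString_mul_jwString_mul_onSite h.ne _ _
    · rw [if_neg h, if_neg h]
  · exact Finset.sum_congr rfl fun f _ => onSite_eq_productOp f siteDouble

end Words

/-! ### Bilinearity of the tree's bond image -/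

section BondImage

variable {q D : ℕ}

/-- Additivity of the bond image in the two-site matrix. -/
theorem bondImage_add (A : MPSTensor q D) (X Y : Matrix (Fin q × Fin q) (Fin q × Fin q) ℂ) :
    bondImage A (X + Y) = bondImage A X + bondImage A Y := by
  simp only [bondImage_eq_opSandwich, opSandwich_add]

/-- Homogeneity of the bond image in the two-site matrix. -/
theorem bondImage_smul (A : MPSTensor q D) (a : ℂ) (X : Matrix (Fin q × Fin q) (Fin q × Fin q) ℂ) :
    bondImage A (a • X) = a • bondImage A X := by
  simp only [bondImage_eq_opSandwich, opSandwich_smul]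

/-- Finite additivity of the bond image in the two-site matrix. -/
theorem bondImage_sum {ι : Type*} (s : Finset ι) (A : MPSTensor q D)
    (X : ι → Matrix (Fin q × Fin q) (Fin q × Fin q) ℂ) :
    bondImage A (∑ i ∈ s, X i) = ∑ i ∈ s, bondImage A (X i) := by
  simp only [bondImage_eq_opSandwich, opSandwich_sum]

end BondImage

/-! ### The intra-cell sweep and the assembly -/

section Assembly

variable {c W : ℕ}

/-- **The intra-cell part, swept.** For the site-by-site cell tensor, the
`superSite κ₀ (toSpin H_cell)`-weighted sweep of `M` is the guarded sum over bonds and spins of the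
`c·W`-fold sweeps of the hopping words, plus `U` times the sum over sites of the sweeps of the doublon
words. -/
theorem opSandwich_cellTensor_toSpin_cell {β : Type*} [Fintype β] [DecidableEq β]
    (k : Fin (c * W) → Fin 4 → Matrix β β ℂ) (t U : ℝ) (M : Matrix β β ℂ) :
    opSandwich (fun S => wordTensor k (finFunctionFinEquiv.symm S))
        (superSite (stripCellEnum c W) (toSpin (hubbardOpenBoxTT' c W t 0 U))) M =
      -(t : ℂ) • (∑ f : Fin c ×ₗ Fin W, ∑ f' : Fin c ×ₗ Fin W, ∑ σ : Fin 2,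
          if (rectBoxGraph c W).Adj f f' then
            iterSweep (c * W) k (fun r => jwWordFamily f f' (siteCreation σ) (siteAnnihilation σ)
              ((cellSiteIndex c W).symm r)) M
          else 0) +
      (U : ℂ) • ∑ f : Fin c ×ₗ Fin W,
          iterSweep (c * W) k (fun r => Function.update (fun _ => (1 : Matrix (Fin 4) (Fin 4) ℂ)) f
            siteDouble ((cellSiteIndex c W).symm r)) M := by
  rw [toSpin_hubbardOpenBoxTT'_zero_eq_sum_productOp, map_add, map_smul, map_smul, map_sum, map_sum,
    opSandwich_add, opSandwich_smul, opSandwich_smul, opSandwich_sum, opSandwich_sum]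
  refine congrArg₂ (fun X Y : Matrix β β ℂ => -(t : ℂ) • X + (U : ℂ) • Y) ?_ ?_
  · refine Finset.sum_congr rfl fun f _ => ?_
    rw [map_sum, opSandwich_sum]
    refine Finset.sum_congr rfl fun f' _ => ?_
    rw [map_sum, opSandwich_sum]
    refine Finset.sum_congr rfl fun σ _ => ?_
    by_cases h : (rectBoxGraph c W).Adj f f'
    · rw [if_pos h, if_pos h]
      exact opSandwich_stripCellEnum_productOp k _ M
    · rw [if_neg h, if_neg h, map_zero, opSandwich_zero]
  · exact Finset.sum_congr rfl fun f _ => opSandwich_stripCellEnum_productOp k _ M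

/-- **The inter-cell part: `2·c·W` sweeps per hopping orientation.** The tree's bond image of
`interCellMatrix κ₀ hc t` for the site-by-site cell tensor is `−t Σ_{y₀ σ}` of (right half-word sweeps
of (left half-word sweeps of `1`)) for the forward and backward hops across the cut. -/
theorem bondImage_cellTensor_interCellMatrix {D : ℕ} (k : Fin (c * W) → Fin 4 → Matrix (Fin D) (Fin D) ℂ)
    (hc : 0 < c) (t : ℝ) :
    bondImage (fun S => wordTensor k (finFunctionFinEquiv.symm S)) (interCellMatrix (stripCellEnum c W) hc t) =
      -(t : ℂ) • ∑ y₀ : Fin W, ∑ σ : Fin 2,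
        (iterSweep (c * W) k
            (fun r => interRightFamily hc y₀ (siteAnnihilation σ) ((cellSiteIndex c W).symm r))
            (iterSweep (c * W) k
              (fun r => interLeftFamily hc y₀ (siteCreation σ * siteParity) ((cellSiteIndex c W).symm r)) 1) +
          iterSweep (c * W) k
            (fun r => interRightFamily hc y₀ (siteCreation σ) ((cellSiteIndex c W).symm r))
            (iterSweep (c * W) k
              (fun r => interLeftFamily hc y₀ (siteParity * siteAnnihilation σ) ((cellSiteIndex c W).symm r))
              1)) := by
  rw [interCellMatrix, bondImage_smul, bondImage_sum]
  refine congrArg (fun X => -(t : ℂ) • X) ?_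
  refine Finset.sum_congr rfl fun y₀ _ => ?_
  rw [bondImage_sum]
  refine Finset.sum_congr rfl fun σ _ => ?_
  rw [bondImage_add, bondImage_stripCellEnum_kronecker, bondImage_stripCellEnum_kronecker]

/-- **Assembly at `t' = 0`: the tree's bond image of the strip-cell bond matrix is the verifier's sweep
program.** `bondImage (cellTensor k) (stripCellBondMatrix κ₀ hc t U)` = (`c·W` plain sweeps of the
intra-cell sweep sum at `M = 1`) + (the inter-cell double sweeps). Every word, coefficient, guard and
nesting order on the right is fixed by the tree's definitions (`stripCellEnum`, `cellSiteIndex`,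
`jwWordFamily`, `interLeftFamily`/`interRightFamily`, `rectBoxGraph`). -/
theorem bondImage_cellTensor_stripCellBondMatrix {D : ℕ}
    (k : Fin (c * W) → Fin 4 → Matrix (Fin D) (Fin D) ℂ) (hc : 0 < c) (t U : ℝ) :
    bondImage (fun S => wordTensor k (finFunctionFinEquiv.symm S))
        (stripCellBondMatrix (stripCellEnum c W) hc t U) =
      iterSweep (c * W) k (fun _ => 1)
        (-(t : ℂ) • (∑ f : Fin c ×ₗ Fin W, ∑ f' : Fin c ×ₗ Fin W, ∑ σ : Fin 2,
            if (rectBoxGraph c W).Adj f f' then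
              iterSweep (c * W) k (fun r => jwWordFamily f f' (siteCreation σ) (siteAnnihilation σ)
                ((cellSiteIndex c W).symm r)) 1
            else 0) +
          (U : ℂ) • ∑ f : Fin c ×ₗ Fin W,
            iterSweep (c * W) k (fun r => Function.update (fun _ => (1 : Matrix (Fin 4) (Fin 4) ℂ)) f
              siteDouble ((cellSiteIndex c W).symm r)) 1) +
      -(t : ℂ) • ∑ y₀ : Fin W, ∑ σ : Fin 2,
        (iterSweep (c * W) k
            (fun r => interRightFamily hc y₀ (siteAnnihilation σ) ((cellSiteIndex c W).symm r))
            (iterSweep (c * W) k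
              (fun r => interLeftFamily hc y₀ (siteCreation σ * siteParity) ((cellSiteIndex c W).symm r)) 1) +
          iterSweep (c * W) k
            (fun r => interRightFamily hc y₀ (siteCreation σ) ((cellSiteIndex c W).symm r))
            (iterSweep (c * W) k
              (fun r => interLeftFamily hc y₀ (siteParity * siteAnnihilation σ) ((cellSiteIndex c W).symm r))
              1)) := by
  rw [stripCellBondMatrix, bondImage_add, bondImage_kronecker_one, opSandwich_cellTensor_toSpin_cell,
    heisenberg_stripCellEnum, bondImage_cellTensor_interCellMatrix]

end Assembly

end Summit.Ventures.CertifiedManyBodySolver.Theorems
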